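import Literature.Topology.FourManifolds.CappellShanesonSimilarityClasses
import Literature.Topology.FourManifolds.CappellShanesonIdealClasses
import HarnessLib

/-!
# Kim–Yamada's trace symmetry `n ↔ 5 - n` WITH ideal classes: the ring isomorphism
# `ℤ[Θₙ] ≅ ℤ[Θ_{5-n}]` (Thm. 3.1), the bijection of ideal class monoids (Cor. 3.2) and of
# conjugacy classes of Cappell–Shaneson matrices (Thm. 3.3)

Topic `Topology/FourManifolds`, namespace `Literature.Topology.FourManifolds`. Sibling of
`CappellShanesonTraceSymmetry.lean`, which renders M. H. Kim, S. Yamada, *Ideal classes and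
Cappell–Shaneson homotopy 4-spheres*, Kyungpook Math. J. 63 (2023) = arXiv:1707.03860, §3 "WITHOUT
ideal classes (the general Latimer–MacDuffee–Taussky correspondence is not in the tree)" through the
polynomial involution `A ↦ A* = pₙ(A)` (`csDual`). The correspondence is now in the tree
(`Literature/LinearAlgebra/Matrix/LatimerMacDuffeeCorrespondence.lean`,
`CappellShanesonSimilarityClasses.lean`), and this file supplies the printed, ideal-theoretic side:

* §1 **Thm. 3.1** (`exists_ringEquiv_adjoinRoot_csPoly_five_sub`, PROVED): "For any integer `n` …
  there is a ring isomorphism `φₙ : ℤ[Θₙ] → ℤ[Θ_{5-n}]` defined by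
  `φₙ(Θₙ) = Θ²_{5-n} + (n - 4) Θ_{5-n} + 1`", with inverse `φ_{5-n}`; here
  `ℤ[Θₙ] = AdjoinRoot (csPoly n)` and `Θ²_{5-n} + (n - 4) Θ_{5-n} + 1 = p_{5-n}(Θ_{5-n})`,
  `pₘ = kyPoly m = x² + (1 - m) x + 1`. Proof as printed: `fₙ(p_{5-n}(Θ_{5-n})) = 0` by the identity
  `fₙ ∘ p_{5-n} = f_{5-n} · q_{5-n}` (`csPoly_five_sub_comp_kyPoly`), and `φ_{5-n} ∘ φₙ = id` by
  `p_{5-n} ∘ pₙ = x + fₙ · (x - n + 2)` (`kyPoly_five_sub_comp_kyPoly`).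
* §2 **Cor. 3.2** (`nonempty_quot_idealClass_csPoly_equiv_five_sub`,
  `natCard_quot_idealClass_csPoly_eq_five_sub`, `isPrincipalIdealRing_adjoinRoot_csPoly_iff_five_sub`):
  "There exists a monoid isomorphism `ψₙ : C(ℤ[Θₙ]) → C(ℤ[Θ_{5-n}])`" — here the induced BIJECTION
  of ideal classes `[I] ↦ [φₙ(I)]` (the tree's class sets `Quot` carry no monoid structure) and the
  equality of class numbers; in particular `ℤ[Θₙ]` has class number one iff `ℤ[Θ_{5-n}]` does
  (Aitchison–Rubinstein's Table 1 lists the traces in the pairs `a, 5 - a`).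
* §3 **Thm. 3.3** (`exists_equiv_quot_isConj_five_sub`, `natCard_quot_isConj_eq_five_sub`): "There
  is a bijection between the set of similarity classes of Cappell-Shaneson matrices with trace `n`
  and the set of similarity classes of matrices with trace `5 - n`", `[A] ↦ [A*]` — from the
  sibling's `csDual` (`isConj_csDual`, `csDual_csDual`, `trace_coe_csDual`); and
  `forall_isConj_iff_five_sub` (one conjugacy class at trace `n` iff one at trace `5 - n`).

* §4 **Cor. 3.2, explicit form** (`map_csIdeal_eq_csIdeal_five_sub`): "`ψₙ` sends `[⟨Θₙ - c, d⟩]` to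
  `[⟨Θ_{5-n} - pₙ(c), d⟩]`" — indeed `φₙ(⟨Θₙ - c, d⟩) = ⟨Θ_{5-n} - pₙ(c), d⟩` as ideals (for
  `d ∣ fₙ(c)`), for the tree's `csIdeal c d n = ⟨Θₙ - c, d⟩` of `CappellShanesonIdealClasses.lean`.

Not here: the compatibility with Gompf equivalence (Lemma 3.5, Thm. A — in the sibling, at the
matrix level).

## References

* [KimYamada2023] M. H. Kim, S. Yamada, Kyungpook Math. J. 63 (2023) 373–411 (arXiv:1707.03860),
  §3: Thm. 3.1, Cor. 3.2, Thm. 3.3, Lemma 3.6.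
* [AitchisonRubinstein1984] I. R. Aitchison, J. H. Rubinstein, Contemp. Math. 35 (1984), Appendix
  "Conjugacy in `SL(3, ℤ)`", Table 1.
-/

noncomputable section

open Polynomial
open scoped MatrixGroups

namespace Literature.Topology.FourManifolds

/-! ### §1 Theorem 3.1: `ℤ[Θₙ] ≅ ℤ[Θ_{5-n}]` -/

section RingIso

/-- `fₙ(p_{5-n}(Θ_{5-n})) = 0` in `ℤ[Θ_{5-n}]`: the element `p_{5-n}(Θ_{5-n}) = Θ²_{5-n} + (n - 4) Θ_{5-n} + 1`
is a root of `fₙ` (KY Thm. 3.1, proof: "the following shows that `f_{5-n}(αₙ) = 0`", with `n` and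
`5 - n` exchanged), by `fₙ ∘ p_{5-n} = f_{5-n} · q_{5-n}`. [cite: KimYamada2023, §3 Thm. 3.1 (proof)] -/
theorem aeval_kyPoly_root_csPoly (n : ℤ) :
    aeval (aeval (AdjoinRoot.root (csPoly (5 - n))) (kyPoly (5 - n))) (csPoly n) = 0 := by
  have h := csPoly_five_sub_comp_kyPoly (5 - n)
  rw [sub_sub_cancel] at h
  rw [← aeval_comp, h, map_mul, AdjoinRoot.aeval_eq, AdjoinRoot.mk_self, zero_mul]

/-- `p_{5-n}(pₙ(Θₙ)) = Θₙ` in `ℤ[Θₙ]` (KY Lemma 3.6, proof: "`p_{5-n}(pₙ(c)) = c + fₙ(c)(c - n + 2)`";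
Thm. 3.1, proof: "`φₙ ∘ φ_{5-n}` is the identity map"). [cite: KimYamada2023, §3 Thm. 3.1 (proof) and Lemma 3.6 (proof)] -/
theorem aeval_kyPoly_aeval_kyPoly_root (n : ℤ) :
    aeval (aeval (AdjoinRoot.root (csPoly n)) (kyPoly n)) (kyPoly (5 - n)) = AdjoinRoot.root (csPoly n) := by
  rw [← aeval_comp, kyPoly_five_sub_comp_kyPoly, map_add, aeval_X, map_mul, AdjoinRoot.aeval_eq,
    AdjoinRoot.mk_self, zero_mul, add_zero]

/-- **Kim–Yamada 2023, Theorem 3.1 (proved).** "For any integer `n`, let `Θₙ` be a root of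
`fₙ(x) = x³ - n x² + (n - 1) x - 1`. Then, there is a ring isomorphism `φₙ : ℤ[Θₙ] → ℤ[Θ_{5-n}]`
defined by `φₙ(Θₙ) = Θ²_{5-n} + (n - 4) Θ_{5-n} + 1`" — with `ℤ[Θₘ] = ℤ[X]/(fₘ) = AdjoinRoot (csPoly m)`
and `Θ²_{5-n} + (n - 4) Θ_{5-n} + 1 = p_{5-n}(Θ_{5-n})`; its inverse is `φ_{5-n}`,
`Θ_{5-n} ↦ pₙ(Θₙ) = Θₙ² + (1 - n) Θₙ + 1`. [cite: KimYamada2023, §3 Thm. 3.1] -/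
theorem exists_ringEquiv_adjoinRoot_csPoly_five_sub (n : ℤ) :
    ∃ φ : AdjoinRoot (csPoly n) ≃+* AdjoinRoot (csPoly (5 - n)),
      φ (AdjoinRoot.root (csPoly n)) = aeval (AdjoinRoot.root (csPoly (5 - n))) (kyPoly (5 - n)) ∧
        φ.symm (AdjoinRoot.root (csPoly (5 - n))) = aeval (AdjoinRoot.root (csPoly n)) (kyPoly n) := by
  -- `φₙ : Θₙ ↦ p_{5-n}(Θ_{5-n})`
  have h₁ : (csPoly n).eval₂ (algebraMap ℤ (AdjoinRoot (csPoly (5 - n))))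
      (aeval (AdjoinRoot.root (csPoly (5 - n))) (kyPoly (5 - n))) = 0 := by
    rw [← aeval_def]
    exact aeval_kyPoly_root_csPoly n
  -- `φ_{5-n} : Θ_{5-n} ↦ pₙ(Θₙ)` (the same statement at `5 - n`, with `5 - (5 - n) = n`)
  have h₂ : (csPoly (5 - n)).eval₂ (algebraMap ℤ (AdjoinRoot (csPoly n)))
      (aeval (AdjoinRoot.root (csPoly n)) (kyPoly n)) = 0 := by
    rw [← aeval_def, ← aeval_comp, csPoly_five_sub_comp_kyPoly, map_mul, AdjoinRoot.aeval_eq,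
      AdjoinRoot.mk_self, zero_mul]
  let G : AdjoinRoot (csPoly n) →ₐ[ℤ] AdjoinRoot (csPoly (5 - n)) :=
    (AdjoinRoot.lift (algebraMap ℤ _) _ h₁).toIntAlgHom
  let G' : AdjoinRoot (csPoly (5 - n)) →ₐ[ℤ] AdjoinRoot (csPoly n) :=
    (AdjoinRoot.lift (algebraMap ℤ _) _ h₂).toIntAlgHom
  have hG : G (AdjoinRoot.root (csPoly n)) = aeval (AdjoinRoot.root (csPoly (5 - n))) (kyPoly (5 - n)) :=
    AdjoinRoot.lift_root h₁
  have hG' : G' (AdjoinRoot.root (csPoly (5 - n))) = aeval (AdjoinRoot.root (csPoly n)) (kyPoly n) :=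
    AdjoinRoot.lift_root h₂
  have hGG' : G.comp G' = AlgHom.id ℤ _ := by
    refine AdjoinRoot.algHom_ext ?_
    have h := kyPoly_five_sub_comp_kyPoly (5 - n)
    rw [sub_sub_cancel] at h
    rw [AlgHom.comp_apply, AlgHom.id_apply, hG', ← aeval_algHom_apply, hG, ← aeval_comp, h, map_add,
      aeval_X, map_mul, AdjoinRoot.aeval_eq, AdjoinRoot.mk_self, zero_mul, add_zero]
  have hG'G : G'.comp G = AlgHom.id ℤ _ := by
    refine AdjoinRoot.algHom_ext ?_
    rw [AlgHom.comp_apply, AlgHom.id_apply, hG, ← aeval_algHom_apply, hG', aeval_kyPoly_aeval_kyPoly_root]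
  refine ⟨(AlgEquiv.ofAlgHom G G' hGG' hG'G).toRingEquiv, ?_, ?_⟩
  · exact hG
  · exact hG'

end RingIso

/-! ### §2 Corollary 3.2: the ideal class monoids of `ℤ[Θₙ]` and `ℤ[Θ_{5-n}]` are in bijection -/

section IdealClasses

/-- **Kim–Yamada 2023, Corollary 3.2 (as a bijection).** "There exists a monoid isomorphism
`ψₙ : C(ℤ[Θₙ]) → C(ℤ[Θ_{5-n}])` for any integer `n`", `[I] ↦ [φₙ(I)]`: here the induced bijection
between the ideal classes `(x) I = (y) J` of nonzero ideals of `AdjoinRoot (csPoly n)` and of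
`AdjoinRoot (csPoly (5 - n))` (transport along the ring isomorphism of Thm. 3.1,
`nonempty_quot_idealClass_equiv_of_ringEquiv`). [cite: KimYamada2023, §3 Cor. 3.2] -/
theorem nonempty_quot_idealClass_csPoly_equiv_five_sub (n : ℤ) :
    Nonempty (Quot (fun I J : {J : Ideal (AdjoinRoot (csPoly n)) // J ≠ ⊥} ↦
        ∃ x y : AdjoinRoot (csPoly n), x ≠ 0 ∧ y ≠ 0 ∧ Ideal.span {x} * I.1 = Ideal.span {y} * J.1) ≃
      Quot (fun I J : {J : Ideal (AdjoinRoot (csPoly (5 - n))) // J ≠ ⊥} ↦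
        ∃ x y : AdjoinRoot (csPoly (5 - n)), x ≠ 0 ∧ y ≠ 0 ∧
          Ideal.span {x} * I.1 = Ideal.span {y} * J.1)) := by
  obtain ⟨φ, -, -⟩ := exists_ringEquiv_adjoinRoot_csPoly_five_sub n
  exact Literature.NumberTheory.ComplexMultiplication.nonempty_quot_idealClass_equiv_of_ringEquiv φ

/-- **`#C(ℤ[Θₙ]) = #C(ℤ[Θ_{5-n}])`**: the orders `ℤ[Θₙ]` and `ℤ[Θ_{5-n}]` have the same class number
(as `Nat.card` of the class sets; KY Cor. 3.2; Aitchison–Rubinstein's Table 1 accordingly lists the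
traces in pairs `a, 5 - a`: "`a = 6, -1`", "`a = 7, -2`", …). [cite: KimYamada2023, §3 Cor. 3.2] [cite: AitchisonRubinstein1984, Appendix (Conjugacy in SL(3,Z)), Table 1] -/
theorem natCard_quot_idealClass_csPoly_eq_five_sub (n : ℤ) :
    Nat.card (Quot (fun I J : {J : Ideal (AdjoinRoot (csPoly n)) // J ≠ ⊥} ↦
        ∃ x y : AdjoinRoot (csPoly n), x ≠ 0 ∧ y ≠ 0 ∧ Ideal.span {x} * I.1 = Ideal.span {y} * J.1)) =
      Nat.card (Quot (fun I J : {J : Ideal (AdjoinRoot (csPoly (5 - n))) // J ≠ ⊥} ↦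
        ∃ x y : AdjoinRoot (csPoly (5 - n)), x ≠ 0 ∧ y ≠ 0 ∧
          Ideal.span {x} * I.1 = Ideal.span {y} * J.1)) := by
  obtain ⟨e⟩ := nonempty_quot_idealClass_csPoly_equiv_five_sub n
  exact Nat.card_congr e

/-- **`ℤ[Θₙ]` is a principal ideal ring iff `ℤ[Θ_{5-n}]` is** (class number one on both sides of the
symmetry at once; transport of principality along the ring isomorphism of Thm. 3.1). [cite: KimYamada2023, §3 Thm. 3.1 and Cor. 3.2] [cite: AitchisonRubinstein1984, Appendix (Conjugacy in SL(3,Z)), Table 1] -/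
theorem isPrincipalIdealRing_adjoinRoot_csPoly_iff_five_sub (n : ℤ) :
    IsPrincipalIdealRing (AdjoinRoot (csPoly n)) ↔ IsPrincipalIdealRing (AdjoinRoot (csPoly (5 - n))) := by
  obtain ⟨φ, -, -⟩ := exists_ringEquiv_adjoinRoot_csPoly_five_sub n
  exact ⟨fun _ ↦ IsPrincipalIdealRing.of_surjective φ.toRingHom φ.surjective,
    fun _ ↦ IsPrincipalIdealRing.of_surjective φ.symm.toRingHom φ.symm.surjective⟩

end IdealClasses

/-! ### §3 Theorem 3.3: conjugacy classes of trace `n` and of trace `5 - n` -/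

section MatrixClasses

/-- **Kim–Yamada 2023, Theorem 3.3.** "There is a bijection between the set of similarity classes of
Cappell-Shaneson matrices with trace `n` and the set of similarity classes of matrices with trace
`5 - n`", `[A] ↦ [A*]`: the sibling's dual `csDual A = A² + (1 - n) A + 1` is a Cappell–Shaneson
matrix of trace `5 - n` (`det_coe_csDual_sub_one`, `trace_coe_csDual`), respects conjugacy
(`isConj_csDual`) and is an involution (`csDual_csDual`), so it induces a bijection `Ψ` of
conjugacy classes in `SL(3, ℤ)`, `Ψ [A] = [A*]`. [cite: KimYamada2023, §3 Thm. 3.3 and Lemma 3.6] -/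
theorem exists_equiv_quot_isConj_five_sub (n : ℤ) :
    ∃ Ψ : Quot (fun A B : {A : SL(3, ℤ) // ((A : Matrix (Fin 3) (Fin 3) ℤ) - 1).det = 1 ∧
                Matrix.trace (A : Matrix (Fin 3) (Fin 3) ℤ) = n} ↦ IsConj A.1 B.1) ≃
          Quot (fun A B : {A : SL(3, ℤ) // ((A : Matrix (Fin 3) (Fin 3) ℤ) - 1).det = 1 ∧
                Matrix.trace (A : Matrix (Fin 3) (Fin 3) ℤ) = 5 - n} ↦ IsConj A.1 B.1),
      ∀ (A : SL(3, ℤ)) (h : ((A : Matrix (Fin 3) (Fin 3) ℤ) - 1).det = 1 ∧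
          Matrix.trace (A : Matrix (Fin 3) (Fin 3) ℤ) = n)
        (h' : ((csDual A : Matrix (Fin 3) (Fin 3) ℤ) - 1).det = 1 ∧
          Matrix.trace (csDual A : Matrix (Fin 3) (Fin 3) ℤ) = 5 - n),
        Ψ (Quot.mk _ ⟨A, h⟩) = Quot.mk _ ⟨csDual A, h'⟩ := by
  let ε : {A : SL(3, ℤ) // ((A : Matrix (Fin 3) (Fin 3) ℤ) - 1).det = 1 ∧
        Matrix.trace (A : Matrix (Fin 3) (Fin 3) ℤ) = n} ≃
      {A : SL(3, ℤ) // ((A : Matrix (Fin 3) (Fin 3) ℤ) - 1).det = 1 ∧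
        Matrix.trace (A : Matrix (Fin 3) (Fin 3) ℤ) = 5 - n} :=
    { toFun := fun A ↦ ⟨csDual A.1, det_coe_csDual_sub_one A.2.1, by rw [trace_coe_csDual A.2.1, A.2.2]⟩
      invFun := fun A ↦ ⟨csDual A.1, det_coe_csDual_sub_one A.2.1, by
        rw [trace_coe_csDual A.2.1, A.2.2, sub_sub_cancel]⟩
      left_inv := fun A ↦ Subtype.ext (csDual_csDual A.2.1)
      right_inv := fun A ↦ Subtype.ext (csDual_csDual A.2.1) }
  refine ⟨Quot.congr ε fun A B ↦ ⟨fun h ↦ isConj_csDual h, fun h ↦ ?_⟩, fun A h h' ↦ rfl⟩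
  have h2 := isConj_csDual h
  change IsConj (csDual (csDual A.1)) (csDual (csDual B.1)) at h2
  rwa [csDual_csDual A.2.1, csDual_csDual B.2.1] at h2

/-- **The numbers of conjugacy classes of Cappell–Shaneson matrices of trace `n` and of trace `5 - n`
are equal** (KY Thm. 3.3; consistent with §2 and the correspondence:
`#classes(n) = #C(ℤ[Θₙ]) = #C(ℤ[Θ_{5-n}]) = #classes(5 - n)`). [cite: KimYamada2023, §3 Thm. 3.3] -/
theorem natCard_quot_isConj_eq_five_sub (n : ℤ) :
    Nat.card (Quot (fun A B : {A : SL(3, ℤ) // ((A : Matrix (Fin 3) (Fin 3) ℤ) - 1).det = 1 ∧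
        Matrix.trace (A : Matrix (Fin 3) (Fin 3) ℤ) = n} ↦ IsConj A.1 B.1)) =
      Nat.card (Quot (fun A B : {A : SL(3, ℤ) // ((A : Matrix (Fin 3) (Fin 3) ℤ) - 1).det = 1 ∧
        Matrix.trace (A : Matrix (Fin 3) (Fin 3) ℤ) = 5 - n} ↦ IsConj A.1 B.1)) := by
  obtain ⟨Ψ, -⟩ := exists_equiv_quot_isConj_five_sub n
  exact Nat.card_congr Ψ

/-- **One conjugacy class at trace `n` iff one conjugacy class at trace `5 - n`**: all
Cappell–Shaneson matrices of trace `n` are conjugate in `SL(3, ℤ)` iff all those of trace `5 - n` are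
(both say that `ℤ[Θₙ] ≅ ℤ[Θ_{5-n}]` is a principal ideal ring, `forall_isConj_iff_isPrincipalIdealRing`).
[cite: KimYamada2023, §3 Thm. 3.3 and Cor. 3.2] [cite: AitchisonRubinstein1984, Appendix (Conjugacy in SL(3,Z)), Table 1] -/
theorem forall_isConj_iff_five_sub (n : ℤ) :
    (∀ A B : SL(3, ℤ), ((A : Matrix (Fin 3) (Fin 3) ℤ) - 1).det = 1 →
        ((B : Matrix (Fin 3) (Fin 3) ℤ) - 1).det = 1 →
        Matrix.trace (A : Matrix (Fin 3) (Fin 3) ℤ) = n → Matrix.trace (B : Matrix (Fin 3) (Fin 3) ℤ) = n →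
        IsConj A B) ↔
      (∀ A B : SL(3, ℤ), ((A : Matrix (Fin 3) (Fin 3) ℤ) - 1).det = 1 →
        ((B : Matrix (Fin 3) (Fin 3) ℤ) - 1).det = 1 →
        Matrix.trace (A : Matrix (Fin 3) (Fin 3) ℤ) = 5 - n →
        Matrix.trace (B : Matrix (Fin 3) (Fin 3) ℤ) = 5 - n → IsConj A B) := by
  rw [forall_isConj_iff_isPrincipalIdealRing, forall_isConj_iff_isPrincipalIdealRing,
    isPrincipalIdealRing_adjoinRoot_csPoly_iff_five_sub]

end MatrixClasses

/-! ### §4 Corollary 3.2, explicit form: `φₙ(⟨Θₙ - c, d⟩) = ⟨Θ_{5-n} - pₙ(c), d⟩` -/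

section Explicit

/-- `pₘ(x) = x² + (1 - m) x + 1` evaluated in a `ℤ`-algebra. [folklore] -/
private theorem aeval_kyPoly {T : Type*} [CommRing T] [Algebra ℤ T] (m : ℤ) (x : T) :
    aeval x (kyPoly m) = x ^ 2 + ((1 - m : ℤ) : T) * x + 1 := by
  simp only [kyPoly, map_add, map_mul, map_pow, map_one, aeval_X, eq_intCast, map_intCast]

/-- **Kim–Yamada 2023, Corollary 3.2 — the explicit value.** "For any integers `c`, `d` with
`fₙ(c) ≡ 0 mod d`, `ψₙ` sends `[⟨Θₙ - c, d⟩]` to `[⟨Θ_{5-n} - pₙ(c), d⟩]` where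
`pₙ(x) = x² + (1 - n) x + 1`"; proof: "we prove that `φₙ(⟨Θₙ - c, d⟩) = ⟨Θ_{5-n} - pₙ(c), d⟩`". Here, for
ANY ring homomorphism `φ : ℤ[Θₙ] → ℤ[Θ_{5-n}]` with `φ(Θₙ) = p_{5-n}(Θ_{5-n})` (Thm. 3.1's `φₙ`), the
image of the tree's `csIdeal c d n = ⟨Θₙ - c, d⟩` is `csIdeal (pₙ(c)) d (5 - n)`: with
`P = p_{5-n}(Θ_{5-n})`, `c* = pₙ(c)`, one has `P - c = (Θ_{5-n} - c*)(Θ_{5-n} + c* + n - 4) + fₙ(c)(c - n + 2)`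
(`p_{5-n}(c*) - c = fₙ(c)(c - n + 2)`, Lemma 3.6) and `Θ_{5-n} - c* = (P - c)(P + c + 1 - n)`
(`pₙ(P) = Θ_{5-n}`). [cite: KimYamada2023, §3 Cor. 3.2 (and its proof)] -/
theorem map_csIdeal_eq_csIdeal_five_sub {n c d : ℤ} (h : d ∣ (csPoly n).eval c)
    (φ : AdjoinRoot (csPoly n) →+* AdjoinRoot (csPoly (5 - n)))
    (hφ : φ (AdjoinRoot.root (csPoly n)) = aeval (AdjoinRoot.root (csPoly (5 - n))) (kyPoly (5 - n))) :
    (csIdeal c d n).map φ = csIdeal ((kyPoly n).eval c) d (5 - n) := by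
  obtain ⟨k, hk⟩ := h
  rw [eval_csPoly] at hk
  -- notation-free abbreviations, as equalities
  have hP : aeval (AdjoinRoot.root (csPoly (5 - n))) (kyPoly (5 - n)) =
      AdjoinRoot.root (csPoly (5 - n)) ^ 2 + ((1 - (5 - n) : ℤ) : AdjoinRoot (csPoly (5 - n))) *
        AdjoinRoot.root (csPoly (5 - n)) + 1 := aeval_kyPoly _ _
  -- `pₙ(P) = Θ_{5-n}` (Thm. 3.1 at `5 - n`)
  have hθP : aeval (aeval (AdjoinRoot.root (csPoly (5 - n))) (kyPoly (5 - n))) (kyPoly n) =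
      AdjoinRoot.root (csPoly (5 - n)) := by
    have h' := aeval_kyPoly_aeval_kyPoly_root (5 - n)
    rwa [sub_sub_cancel] at h'
  rw [aeval_kyPoly] at hθP
  have hcstar : ((((kyPoly n).eval c : ℤ)) : AdjoinRoot (csPoly (5 - n))) =
      (c : AdjoinRoot (csPoly (5 - n))) ^ 2 + ((1 - n : ℤ) : AdjoinRoot (csPoly (5 - n))) * c + 1 := by
    rw [eval_kyPoly]
    push_cast
    ring
  have hkT : (c : AdjoinRoot (csPoly (5 - n))) ^ 3 - (n : AdjoinRoot (csPoly (5 - n))) * c ^ 2 +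
      ((n : AdjoinRoot (csPoly (5 - n))) - 1) * c - 1 = (d : AdjoinRoot (csPoly (5 - n))) * k := by
    have h' := congrArg (Int.cast : ℤ → AdjoinRoot (csPoly (5 - n))) hk
    push_cast at h'
    exact h'
  -- the image of the generators
  have hφ' : φ (csRoot n) = aeval (AdjoinRoot.root (csPoly (5 - n))) (kyPoly (5 - n)) := hφ
  have hgen : (csIdeal c d n).map φ =
      Ideal.span {aeval (AdjoinRoot.root (csPoly (5 - n))) (kyPoly (5 - n)) - (c : AdjoinRoot (csPoly (5 - n))),
        (d : AdjoinRoot (csPoly (5 - n)))} := by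
    rw [csIdeal, Ideal.map_span, Set.image_pair, map_sub, map_intCast, map_intCast, hφ']
  rw [hgen, csIdeal]
  apply le_antisymm
  · -- `P - c ∈ ⟨Θ' - c*, d⟩` and `d ∈ ⟨Θ' - c*, d⟩`
    rw [Ideal.span_le, Set.insert_subset_iff, Set.singleton_subset_iff, SetLike.mem_coe,
      SetLike.mem_coe]
    refine ⟨Ideal.mem_span_pair.2 ⟨AdjoinRoot.root (csPoly (5 - n)) +
        (((kyPoly n).eval c : ℤ) : AdjoinRoot (csPoly (5 - n))) + ((n - 4 : ℤ) : AdjoinRoot (csPoly (5 - n))),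
      ((k * (c - n + 2) : ℤ) : AdjoinRoot (csPoly (5 - n))), ?_⟩,
      Ideal.subset_span (Set.mem_insert_of_mem _ rfl)⟩
    rw [hP, hcstar]
    push_cast
    linear_combination (-((c : AdjoinRoot (csPoly (5 - n))) - n + 2)) * hkT
  · -- `Θ' - c* ∈ ⟨P - c, d⟩` and `d ∈ ⟨P - c, d⟩`
    rw [Ideal.span_le, Set.insert_subset_iff, Set.singleton_subset_iff, SetLike.mem_coe,
      SetLike.mem_coe]
    refine ⟨Ideal.mem_span_pair.2 ⟨aeval (AdjoinRoot.root (csPoly (5 - n))) (kyPoly (5 - n)) +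
        (c : AdjoinRoot (csPoly (5 - n))) + ((1 - n : ℤ) : AdjoinRoot (csPoly (5 - n))), 0, ?_⟩,
      Ideal.subset_span (Set.mem_insert_of_mem _ rfl)⟩
    rw [hcstar]
    push_cast at hθP ⊢
    linear_combination hθP

end Explicit

end Literature.Topology.FourManifolds

end
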